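import Mathlib
import HarnessLib
import Literature.Dynamics.Hyperbolic.RGFlowStableManifold

/-!
# The discrete stable-manifold theorem for scale-indexed RG recursions, II: uniqueness,
# Lipschitz dependence on the data, and the second fixed point
# (Adams–Buchholz–Kotecký–Müller 2019, Thm 12.1 (uniqueness/continuity) and Lemma 12.6)

Topic `Literature/Dynamics/Hyperbolic`; continuation of `RGFlowStableManifold.lean` (the setting —
steps `T_k(x,y) = (A_k x + B_k y, S_k(x,y))`, tuned trajectories `IsTrajectory` with `y_0 = y₀`,
`x_N = 0`, the tube `InTube`, the hypotheses `IsRGStep` — is described there).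

Here the contraction estimate is run directly on the DIFFERENCE of two trajectories of two nearby
systems `(A, B, S, y₀)` and `(A', B', S', y₀')` on the same scale of spaces: if `D` bounds the
weighted distance `sup_k η^{-k} max(‖x_k - x'_k‖, ‖y_k - y'_k‖)` then so does `κ D + Δ`, where
`Δ` is linear in the size of the perturbation of the data ([ABKM19] (12.43)–(12.46) applied to a
difference; the `Δ`-terms are the ones estimated in the proof of Lemma 12.6); iterating,
the weighted distance is at most `Δ / (1 - κ)`.  Consequences:
* uniqueness of the tuned trajectory in the tube ([ABKM19] Thm 12.1: "a unique `Ẑ`");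
* Lipschitz dependence of the tuned trajectory on `(A, B, S, y₀)` — the quantitative content of
  the smoothness assertion of [ABKM19] Thm 12.1 / [Bry09] Thm 2.16 that the fine-tuning argument
  actually consumes;
* **the second fixed point** ([ABKM19] Lemma 12.6): if the whole system depends on a parameter
  `h ∈ E_0` in a Lipschitz way with small constants, the map `h ↦ x_0(h)` (initial relevant
  coordinate of the tuned trajectory of system `h`) is a contraction of a ball and has a fixed
  point `x_0(h⋆) = h⋆` — in [ABKM19], `h = ℋ` is the relevant Hamiltonian whose quadratic part is
  fed into the Gaussian covariance, and `Π_{H_0} Ẑ(𝒦, ℋ(𝒦)) = ℋ(𝒦)` ((12.50)) makes the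
  renormalised representation of the partition function exact up to a scalar ((12.26)–(12.27)).

## Contents (everything is proved; no named fact is introduced)

* `RGFlow.dist_step` — one contraction step for the difference of two trajectories;
  `RGFlow.dist_iterate` — its iteration; **`RGFlow.dist_le_of_isTrajectory`** — the weighted
  distance of the tuned trajectories of two nearby systems is `≤ Δ/(1-κ)`.
* **`RGFlow.isTrajectory_unique`** — uniqueness in the tube.
* **`RGFlow.exists_isTrajectory_initial_eq`** — Lemma 12.6: existence of a parameter `h⋆`,
  `‖h⋆‖ ≤ ρ`, and a tuned trajectory of system `h⋆` in the tube with `x_0 = h⋆`.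

## References
* [ABKM19] S. Adams, S. Buchholz, R. Kotecký, S. Müller, *Cauchy–Born rule from microscopic
  models with non-convex potentials*, arXiv:1910.13564, Ch. 12: Theorem 12.1, (12.43)–(12.49),
  Lemma 12.6 with its proof (12.51)–(12.56) [AdamsBuchholzKoteckyMuller2019].
* [Bry09] D. C. Brydges, *Lectures on the renormalisation group*, IAS/Park City Math. Ser. 16
  (2009), §2.10, Theorem 2.16 [Brydges2009].
-/

noncomputable section

open Set Function Metric Filter
open scoped NNReal Topology

namespace Literature.Dynamics.Hyperbolic

namespace RGFlow

variable {E F : ℕ → Type*} [∀ k, NormedAddCommGroup (E k)] [∀ k, NormedSpace ℝ (E k)]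
  [∀ k, NormedAddCommGroup (F k)] [∀ k, NormedSpace ℝ (F k)]

/-! ## §5 The contraction estimate for the difference of two trajectories -/

section comparison

variable {N : ℕ} {r α β σ η κ ε a b l m : ℝ}
  {A A' : ∀ k, E k ≃L[ℝ] E (k + 1)} {B B' : ∀ k, F k →L[ℝ] E (k + 1)}
  {S S' : ∀ k, E k → F k → F (k + 1)} {y₀ y₀' : F 0}
  {x x' : ∀ k, E k} {y y' : ∀ k, F k}

/-- The size of the perturbation of the data, as it enters one contraction step:
`Δ = max(m, lε/η, (αb + a(η + β + b))ε)` where `a, b, l, m` bound `A⁻¹ - A'⁻¹`, `B - B'`,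
`S - S'` (relative to the size of the argument) and `y₀ - y₀'`.
[cite: AdamsBuchholzKoteckyMuller2019, Ch. 12, eqs. (12.51)–(12.53)] -/
def pertSize (α β η ε a b l m : ℝ) : ℝ :=
  max m (max (l * ε / η) ((α * b + a * (η + β + b)) * ε))

/-- **One contraction step for the difference of two trajectories.**  Let `(x, y)` be a tuned
trajectory of `(A, B, S, y₀)` (which satisfies `IsRGStep N r α β σ`) and `(x', y')` one of
`(A', B', S', y₀')`, both in the `ε`-tube (`ε ≤ r`).  If `D ≥ 0` bounds the weighted distance,
`‖x_k - x'_k‖, ‖y_k - y'_k‖ ≤ D η^k` (`k ≤ N`), then so does `κ D + Δ`: the irrelevant difference at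
scale `k+1` is `S_k(x_k,y_k) - S_k(x'_k,y'_k) + (S_k - S'_k)(x'_k,y'_k)`, of size
`≤ (σ D + l ε) η^k ≤ (κ D + Δ) η^{k+1}`; the relevant one at scale `k < N`, solved backwards, is
`A_k⁻¹[(x_{k+1} - x'_{k+1}) - (B_k y_k - B'_k y'_k)] + (A_k⁻¹ - A'_k⁻¹)(x'_{k+1} - B'_k y'_k)`, of
size `≤ (α(η+β) D + (αb + a(η+β+b)) ε) η^k` ([ABKM19] (12.43)–(12.46) for differences).
[cite: AdamsBuchholzKoteckyMuller2019, Ch. 12, eqs. (12.43)–(12.46)] -/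
theorem dist_step (hT : IsRGStep N r α β σ A B S) (hη : 0 < η) (hη1 : η ≤ 1)
    (hα : 0 ≤ α) (hβ : 0 ≤ β) (hσ : 0 ≤ σ) (hκ₁ : α * (η + β) ≤ κ) (hκ₂ : σ ≤ κ * η)
    (hε : 0 ≤ ε) (hεr : ε ≤ r)
    (htr : IsTrajectory N A B S y₀ x y) (htr' : IsTrajectory N A' B' S' y₀' x' y')
    (htu : InTube N η ε x y) (htu' : InTube N η ε x' y')
    (ha0 : 0 ≤ a) (hb0 : 0 ≤ b) (hl0 : 0 ≤ l)
    (ha : ∀ k, k < N → ∀ w : E (k + 1), ‖(A k).symm w - (A' k).symm w‖ ≤ a * ‖w‖)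
    (hb : ∀ k, k < N → ∀ v : F k, ‖B k v - B' k v‖ ≤ b * ‖v‖)
    (hl : ∀ k, k < N → ∀ (u : E k) (v : F k), ‖u‖ ≤ r → ‖v‖ ≤ r →
      ‖S k u v - S' k u v‖ ≤ l * max ‖u‖ ‖v‖)
    (hm : ‖y₀ - y₀'‖ ≤ m) {D : ℝ} (hD0 : 0 ≤ D)
    (hD : ∀ k, k ≤ N → ‖x k - x' k‖ ≤ D * η ^ k ∧ ‖y k - y' k‖ ≤ D * η ^ k) :
    ∀ k, k ≤ N → ‖x k - x' k‖ ≤ (κ * D + pertSize α β η ε a b l m) * η ^ k ∧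
      ‖y k - y' k‖ ≤ (κ * D + pertSize α β η ε a b l m) * η ^ k := by
  set Δ := pertSize α β η ε a b l m with hΔ
  have hκ0 : 0 ≤ κ := le_trans (mul_nonneg hα (add_nonneg hη.le hβ)) hκ₁
  have hm0 : 0 ≤ m := (norm_nonneg _).trans hm
  have hΔm : m ≤ Δ := le_max_left _ _
  have hΔl : l * ε / η ≤ Δ := (le_max_left _ _).trans (le_max_right _ _)
  have hΔab : (α * b + a * (η + β + b)) * ε ≤ Δ := (le_max_right _ _).trans (le_max_right _ _)
  have hΔ0 : 0 ≤ Δ := hm0.trans hΔm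
  have hηk : ∀ k : ℕ, 0 ≤ η ^ k := fun k => pow_nonneg hη.le k
  have hηk1 : ∀ k : ℕ, η ^ k ≤ 1 := fun k => pow_le_one₀ hη.le hη1
  -- tube members are in the `r`-ball
  have hball : ∀ (t : ℝ) (k : ℕ), t ≤ ε * η ^ k → t ≤ r :=
    fun t k ht => ht.trans ((mul_le_of_le_one_right hε (hηk1 k)).trans hεr)
  intro k hk
  constructor
  · -- relevant component, solved backwards
    rcases Nat.lt_or_ge k N with hkN | hkN
    · have hk1 : k + 1 ≤ N := hkN
      -- backward form of the relevant recursion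
      have hxk : x k = (A k).symm (x (k + 1) - B k (y k)) := by
        rw [htr.rel k hkN, add_sub_cancel_right, ContinuousLinearEquiv.symm_apply_apply]
      have hxk' : x' k = (A' k).symm (x' (k + 1) - B' k (y' k)) := by
        rw [htr'.rel k hkN, add_sub_cancel_right, ContinuousLinearEquiv.symm_apply_apply]
      have hsplit : x k - x' k =
          (A k).symm ((x (k + 1) - x' (k + 1)) - (B k (y k - y' k) + (B k (y' k) - B' k (y' k))))
            + ((A k).symm (x' (k + 1) - B' k (y' k)) - (A' k).symm (x' (k + 1) - B' k (y' k))) := by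
        have hPQ : (x (k + 1) - x' (k + 1)) - (B k (y k - y' k) + (B k (y' k) - B' k (y' k))) =
            (x (k + 1) - B k (y k)) - (x' (k + 1) - B' k (y' k)) := by
          rw [map_sub]; abel
        rw [hPQ, map_sub (A k).symm (x (k + 1) - B k (y k)) (x' (k + 1) - B' k (y' k)), ← hxk,
          ← hxk']
        abel
      -- bounds on the pieces
      have h1 : ‖x (k + 1) - x' (k + 1)‖ ≤ D * η ^ (k + 1) := (hD (k + 1) hk1).1
      have h2 : ‖B k (y k - y' k)‖ ≤ β * (D * η ^ k) :=
        (hT.norm_B_le k hkN _).trans (mul_le_mul_of_nonneg_left (hD k hk).2 hβ)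
      have h3 : ‖B k (y' k) - B' k (y' k)‖ ≤ b * (ε * η ^ k) :=
        (hb k hkN _).trans (mul_le_mul_of_nonneg_left (htu' k hk).2 hb0)
      have h4 : ‖x' (k + 1) - B' k (y' k)‖ ≤ ε * η ^ (k + 1) + (β + b) * (ε * η ^ k) := by
        refine (norm_sub_le _ _).trans (add_le_add (htu' (k + 1) hk1).1 ?_)
        have : B' k (y' k) = B k (y' k) - (B k (y' k) - B' k (y' k)) := by abel
        rw [this]
        refine (norm_sub_le _ _).trans ?_
        calc ‖B k (y' k)‖ + ‖B k (y' k) - B' k (y' k)‖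
            ≤ β * ‖y' k‖ + b * ‖y' k‖ := add_le_add (hT.norm_B_le k hkN _) (hb k hkN _)
          _ ≤ β * (ε * η ^ k) + b * (ε * η ^ k) :=
              add_le_add (mul_le_mul_of_nonneg_left (htu' k hk).2 hβ)
                (mul_le_mul_of_nonneg_left (htu' k hk).2 hb0)
          _ = (β + b) * (ε * η ^ k) := by ring
      rw [hsplit]
      refine (norm_add_le _ _).trans ?_
      have hfirst : ‖(A k).symm ((x (k + 1) - x' (k + 1)) -
            (B k (y k - y' k) + (B k (y' k) - B' k (y' k))))‖
          ≤ α * (D * η ^ (k + 1) + (β * (D * η ^ k) + b * (ε * η ^ k))) := by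
        refine (hT.norm_symm_le k hkN _).trans (mul_le_mul_of_nonneg_left ?_ hα)
        exact (norm_sub_le _ _).trans (add_le_add h1 ((norm_add_le _ _).trans (add_le_add h2 h3)))
      have hsecond : ‖(A k).symm (x' (k + 1) - B' k (y' k)) - (A' k).symm (x' (k + 1) - B' k (y' k))‖
          ≤ a * (ε * η ^ (k + 1) + (β + b) * (ε * η ^ k)) :=
        (ha k hkN _).trans (mul_le_mul_of_nonneg_left h4 ha0)
      refine (add_le_add hfirst hsecond).trans ?_
      have hpow : η ^ (k + 1) = η ^ k * η := pow_succ η k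
      rw [hpow]
      have hgoal : α * (D * (η ^ k * η) + (β * (D * η ^ k) + b * (ε * η ^ k))) +
          a * (ε * (η ^ k * η) + (β + b) * (ε * η ^ k))
          = (α * (η + β) * D + (α * b + a * (η + β + b)) * ε) * η ^ k := by ring
      rw [hgoal]
      refine mul_le_mul_of_nonneg_right ?_ (hηk k)
      exact add_le_add (mul_le_mul_of_nonneg_right hκ₁ hD0) hΔab
    · obtain rfl : k = N := le_antisymm hk hkN
      rw [htr.final, htr'.final, sub_zero, norm_zero]
      exact mul_nonneg (add_nonneg (mul_nonneg hκ0 hD0) hΔ0) (hηk _)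
  · -- irrelevant component, forwards
    rcases Nat.eq_zero_or_eq_succ_pred k with hk0 | hks
    · subst hk0
      rw [htr.init, htr'.init, pow_zero, mul_one]
      exact hm.trans (hΔm.trans (le_add_of_nonneg_left (mul_nonneg hκ0 hD0)))
    · set j := k.pred with hj
      rw [hks] at hk ⊢
      have hjN : j < N := Nat.lt_of_succ_le hk
      have hjle : j ≤ N := hjN.le
      rw [htr.irrel j hjN, htr'.irrel j hjN]
      have hsplit : S j (x j) (y j) - S' j (x' j) (y' j) =
          (S j (x j) (y j) - S j (x' j) (y' j)) + (S j (x' j) (y' j) - S' j (x' j) (y' j)) := by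
        abel
      rw [hsplit]
      have h1 : ‖S j (x j) (y j) - S j (x' j) (y' j)‖ ≤ σ * (D * η ^ j) := by
        refine (hT.lipschitz j hjN _ _ _ _ (hball _ j (htu j hjle).1) (hball _ j (htu' j hjle).1)
          (hball _ j (htu j hjle).2) (hball _ j (htu' j hjle).2)).trans ?_
        exact mul_le_mul_of_nonneg_left (max_le (hD j hjle).1 (hD j hjle).2) hσ
      have h2 : ‖S j (x' j) (y' j) - S' j (x' j) (y' j)‖ ≤ l * (ε * η ^ j) := by
        refine (hl j hjN _ _ (hball _ j (htu' j hjle).1) (hball _ j (htu' j hjle).2)).trans ?_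
        exact mul_le_mul_of_nonneg_left (max_le (htu' j hjle).1 (htu' j hjle).2) hl0
      refine ((norm_add_le _ _).trans (add_le_add h1 h2)).trans ?_
      rw [pow_succ]
      -- `σ D η^j + l ε η^j ≤ (κ D + Δ) η^j η`
      have hσ' : σ * (D * η ^ j) ≤ κ * D * (η ^ j * η) := by
        have := mul_le_mul_of_nonneg_right hκ₂ (mul_nonneg hD0 (hηk j))
        calc σ * (D * η ^ j) ≤ κ * η * (D * η ^ j) := this
          _ = κ * D * (η ^ j * η) := by ring
      have hl' : l * (ε * η ^ j) ≤ Δ * (η ^ j * η) := by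
        have h := mul_le_mul_of_nonneg_right hΔl (mul_nonneg (hηk j) hη.le)
        calc l * (ε * η ^ j) = l * ε / η * (η ^ j * η) := by field_simp
          _ ≤ Δ * (η ^ j * η) := h
      calc σ * (D * η ^ j) + l * (ε * η ^ j) ≤ κ * D * (η ^ j * η) + Δ * (η ^ j * η) :=
            add_le_add hσ' hl'
        _ = (κ * D + Δ) * (η ^ j * η) := by ring

/-- Iteration of `dist_step`: after `n` steps the weighted distance is bounded by
`κ^n · 2ε + Δ/(1-κ)` (both trajectories start in the `ε`-tube, so `2ε` is an initial bound).
[cite: AdamsBuchholzKoteckyMuller2019, Ch. 12, eqs. (12.43)–(12.46)] -/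
theorem dist_iterate (hT : IsRGStep N r α β σ A B S) (hη : 0 < η) (hη1 : η ≤ 1)
    (hα : 0 ≤ α) (hβ : 0 ≤ β) (hσ : 0 ≤ σ) (hκ₁ : α * (η + β) ≤ κ) (hκ₂ : σ ≤ κ * η)
    (hκ : κ < 1) (hε : 0 ≤ ε) (hεr : ε ≤ r)
    (htr : IsTrajectory N A B S y₀ x y) (htr' : IsTrajectory N A' B' S' y₀' x' y')
    (htu : InTube N η ε x y) (htu' : InTube N η ε x' y')
    (ha0 : 0 ≤ a) (hb0 : 0 ≤ b) (hl0 : 0 ≤ l)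
    (ha : ∀ k, k < N → ∀ w : E (k + 1), ‖(A k).symm w - (A' k).symm w‖ ≤ a * ‖w‖)
    (hb : ∀ k, k < N → ∀ v : F k, ‖B k v - B' k v‖ ≤ b * ‖v‖)
    (hl : ∀ k, k < N → ∀ (u : E k) (v : F k), ‖u‖ ≤ r → ‖v‖ ≤ r →
      ‖S k u v - S' k u v‖ ≤ l * max ‖u‖ ‖v‖)
    (hm : ‖y₀ - y₀'‖ ≤ m) (n : ℕ) :
    ∀ k, k ≤ N →
      ‖x k - x' k‖ ≤ (κ ^ n * (2 * ε) + pertSize α β η ε a b l m / (1 - κ)) * η ^ k ∧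
      ‖y k - y' k‖ ≤ (κ ^ n * (2 * ε) + pertSize α β η ε a b l m / (1 - κ)) * η ^ k := by
  set Δ := pertSize α β η ε a b l m with hΔ
  have hκ0 : 0 ≤ κ := le_trans (mul_nonneg hα (add_nonneg hη.le hβ)) hκ₁
  have hΔ0 : 0 ≤ Δ := ((norm_nonneg _).trans hm).trans (le_max_left _ _)
  have hΔ1 : 0 ≤ Δ / (1 - κ) := div_nonneg hΔ0 (by linarith)
  induction n with
  | zero =>
      intro k hk
      have hb2 : ‖x k - x' k‖ ≤ 2 * ε * η ^ k ∧ ‖y k - y' k‖ ≤ 2 * ε * η ^ k := by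
        constructor
        · calc ‖x k - x' k‖ ≤ ‖x k‖ + ‖x' k‖ := norm_sub_le _ _
            _ ≤ ε * η ^ k + ε * η ^ k := add_le_add (htu k hk).1 (htu' k hk).1
            _ = 2 * ε * η ^ k := by ring
        · calc ‖y k - y' k‖ ≤ ‖y k‖ + ‖y' k‖ := norm_sub_le _ _
            _ ≤ ε * η ^ k + ε * η ^ k := add_le_add (htu k hk).2 (htu' k hk).2
            _ = 2 * ε * η ^ k := by ring
      have hηk : 0 ≤ η ^ k := pow_nonneg hη.le k
      rw [pow_zero, one_mul]
      exact ⟨hb2.1.trans (mul_le_mul_of_nonneg_right (le_add_of_nonneg_right hΔ1) hηk),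
        hb2.2.trans (mul_le_mul_of_nonneg_right (le_add_of_nonneg_right hΔ1) hηk)⟩
  | succ n ih =>
      have hDn0 : 0 ≤ κ ^ n * (2 * ε) + Δ / (1 - κ) :=
        add_nonneg (mul_nonneg (pow_nonneg hκ0 n) (by linarith)) hΔ1
      have hstep := dist_step hT hη hη1 hα hβ hσ hκ₁ hκ₂ hε hεr htr htr' htu htu' ha0 hb0 hl0
        ha hb hl hm hDn0 ih
      have hid : κ * (κ ^ n * (2 * ε) + Δ / (1 - κ)) + Δ = κ ^ (n + 1) * (2 * ε) + Δ / (1 - κ) := by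
        have h1 : (1 - κ) ≠ 0 := by linarith
        field_simp
        ring
      intro k hk
      have h := hstep k hk
      rw [hid] at h
      exact h

/-- **Lipschitz dependence of the tuned trajectory on the data** ([ABKM19] Thm 12.1, the
quantitative continuity content; [Bry09] Thm 2.16).  Two tuned trajectories in the `ε`-tube, of
`(A, B, S, y₀)` (satisfying `IsRGStep`) and of a perturbed system `(A', B', S', y₀')` with
`‖A_k⁻¹ - A'_k⁻¹‖ ≤ a`, `‖B_k - B'_k‖ ≤ b`, `‖(S_k - S'_k)(u,v)‖ ≤ l max(‖u‖,‖v‖)`,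
`‖y₀ - y₀'‖ ≤ m`, are within weighted distance `Δ/(1-κ)`:
`‖x_k - x'_k‖, ‖y_k - y'_k‖ ≤ η^k Δ/(1-κ)` for `k ≤ N`, `Δ = pertSize α β η ε a b l m`.
[cite: AdamsBuchholzKoteckyMuller2019, Thm 12.1] -/
theorem dist_le_of_isTrajectory (hT : IsRGStep N r α β σ A B S) (hη : 0 < η) (hη1 : η ≤ 1)
    (hα : 0 ≤ α) (hβ : 0 ≤ β) (hσ : 0 ≤ σ) (hκ₁ : α * (η + β) ≤ κ) (hκ₂ : σ ≤ κ * η)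
    (hκ : κ < 1) (hε : 0 ≤ ε) (hεr : ε ≤ r)
    (htr : IsTrajectory N A B S y₀ x y) (htr' : IsTrajectory N A' B' S' y₀' x' y')
    (htu : InTube N η ε x y) (htu' : InTube N η ε x' y')
    (ha0 : 0 ≤ a) (hb0 : 0 ≤ b) (hl0 : 0 ≤ l)
    (ha : ∀ k, k < N → ∀ w : E (k + 1), ‖(A k).symm w - (A' k).symm w‖ ≤ a * ‖w‖)
    (hb : ∀ k, k < N → ∀ v : F k, ‖B k v - B' k v‖ ≤ b * ‖v‖)
    (hl : ∀ k, k < N → ∀ (u : E k) (v : F k), ‖u‖ ≤ r → ‖v‖ ≤ r →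
      ‖S k u v - S' k u v‖ ≤ l * max ‖u‖ ‖v‖)
    (hm : ‖y₀ - y₀'‖ ≤ m) :
    ∀ k, k ≤ N → ‖x k - x' k‖ ≤ pertSize α β η ε a b l m / (1 - κ) * η ^ k ∧
      ‖y k - y' k‖ ≤ pertSize α β η ε a b l m / (1 - κ) * η ^ k := by
  set Δ := pertSize α β η ε a b l m with hΔ
  have hκ0 : 0 ≤ κ := le_trans (mul_nonneg hα (add_nonneg hη.le hβ)) hκ₁
  intro k hk
  -- the bounds `κ^n · 2ε + Δ/(1-κ)` tend to `Δ/(1-κ)`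
  have hlim : Tendsto (fun n : ℕ => (κ ^ n * (2 * ε) + Δ / (1 - κ)) * η ^ k) atTop
      (𝓝 ((0 * (2 * ε) + Δ / (1 - κ)) * η ^ k)) :=
    (((tendsto_pow_atTop_nhds_zero_of_lt_one hκ0 hκ).mul_const _).add_const _).mul_const _
  rw [zero_mul, zero_add] at hlim
  have hiter := fun n => dist_iterate hT hη hη1 hα hβ hσ hκ₁ hκ₂ hκ hε hεr htr htr' htu htu'
    ha0 hb0 hl0 ha hb hl hm n k hk
  exact ⟨ge_of_tendsto' hlim fun n => (hiter n).1, ge_of_tendsto' hlim fun n => (hiter n).2⟩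

/-- **Uniqueness of the tuned trajectory in the tube** ([ABKM19] Thm 12.1: the fixed point `Ẑ`
of `𝒯` is unique in the ball; [Bry09] Thm 2.16).  Two tuned trajectories of the same system with
the same datum `y₀`, both in the `ε`-tube (`ε ≤ r`), coincide up to the horizon.
[cite: AdamsBuchholzKoteckyMuller2019, Thm 12.1] -/
theorem isTrajectory_unique (hT : IsRGStep N r α β σ A B S) (hη : 0 < η) (hη1 : η ≤ 1)
    (hα : 0 ≤ α) (hβ : 0 ≤ β) (hσ : 0 ≤ σ) (hκ₁ : α * (η + β) ≤ κ) (hκ₂ : σ ≤ κ * η)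
    (hκ : κ < 1) (hε : 0 ≤ ε) (hεr : ε ≤ r)
    (htr : IsTrajectory N A B S y₀ x y) (htr' : IsTrajectory N A B S y₀ x' y')
    (htu : InTube N η ε x y) (htu' : InTube N η ε x' y') :
    ∀ k, k ≤ N → x k = x' k ∧ y k = y' k := by
  have h := dist_le_of_isTrajectory (a := 0) (b := 0) (l := 0) (m := 0) hT hη hη1 hα hβ hσ hκ₁
    hκ₂ hκ hε hεr htr htr' htu htu' le_rfl le_rfl le_rfl (fun k _ w => by simp)
    (fun k _ v => by simp) (fun k _ u v _ _ => by simp) (by simp)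
  have hΔ : pertSize α β η ε 0 0 0 0 = 0 := by simp [pertSize]
  intro k hk
  have hk' := h k hk
  rw [hΔ, zero_div, zero_mul] at hk'
  exact ⟨sub_eq_zero.1 (norm_le_zero_iff.1 hk'.1), sub_eq_zero.1 (norm_le_zero_iff.1 hk'.2)⟩

end comparison

/-! ## §6 The second fixed point: tuning the parameter ([ABKM19] Lemma 12.6) -/

section secondFixedPoint

variable [∀ k, CompleteSpace (E k)] [∀ k, CompleteSpace (F k)]
  {N : ℕ} {r α β σ η κ ε ρ a₀ b₀ l₀ m₀ : ℝ}
  {A : E 0 → ∀ k, E k ≃L[ℝ] E (k + 1)} {B : E 0 → ∀ k, F k →L[ℝ] E (k + 1)}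
  {S : E 0 → ∀ k, E k → F k → F (k + 1)} {y₀ : E 0 → F 0}

/-- **The second fixed point** ([ABKM19] Lemma 12.6).  Let the RG system depend on a parameter
`h ∈ E_0` with `‖h‖ ≤ ρ`: every `(A^h, B^h, S^h)` satisfies `IsRGStep N r α β σ`, the data obey
`‖y₀^h‖ ≤ (1-κ)ε`, and the dependence on `h` is Lipschitz —
`‖(A^h_k)⁻¹ - (A^{h'}_k)⁻¹‖ ≤ a₀‖h-h'‖`, `‖B^h_k - B^{h'}_k‖ ≤ b₀‖h-h'‖`,
`‖(S^h_k - S^{h'}_k)(u,v)‖ ≤ l₀‖h-h'‖ max(‖u‖,‖v‖)` on the `r`-ball, `‖y₀^h - y₀^{h'}‖ ≤ m₀‖h-h'‖`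
— with `max(m₀, l₀ε/η, (αb₀ + a₀(η+β+2ρb₀))ε) ≤ (1-κ)/2` (so that `h ↦ x_0(h)`, the initial
relevant coordinate of the tuned trajectory of system `h`, is a `1/2`-contraction, cf.
(12.54)–(12.56))
and `ε ≤ ρ` (so that it maps the `ρ`-ball into itself).  Then there is `h⋆`, `‖h⋆‖ ≤ ρ`, and a
tuned trajectory of system `h⋆` in the `ε`-tube whose initial relevant coordinate IS `h⋆`:
`x_0 = h⋆` — [ABKM19] (12.50), `Π_{H_0} Ẑ(𝒦, ℋ(𝒦)) = ℋ(𝒦)`.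
[cite: AdamsBuchholzKoteckyMuller2019, Lemma 12.6] -/
theorem exists_isTrajectory_initial_eq (hη : 0 < η) (hη1 : η ≤ 1) (hα : 0 ≤ α) (hβ : 0 ≤ β)
    (hσ : 0 ≤ σ) (hκ₁ : α * (η + β) ≤ κ) (hκ₂ : σ ≤ κ * η) (hκ : κ < 1) (hε : 0 ≤ ε)
    (hεr : ε ≤ r) (hερ : ε ≤ ρ) (ha0 : 0 ≤ a₀) (hb0 : 0 ≤ b₀) (hl0 : 0 ≤ l₀)
    (hT : ∀ h : E 0, ‖h‖ ≤ ρ → IsRGStep N r α β σ (A h) (B h) (S h))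
    (hy₀ : ∀ h : E 0, ‖h‖ ≤ ρ → ‖y₀ h‖ ≤ (1 - κ) * ε)
    (ha : ∀ h h' : E 0, ‖h‖ ≤ ρ → ‖h'‖ ≤ ρ → ∀ k, k < N → ∀ w : E (k + 1),
      ‖(A h k).symm w - (A h' k).symm w‖ ≤ a₀ * ‖h - h'‖ * ‖w‖)
    (hb : ∀ h h' : E 0, ‖h‖ ≤ ρ → ‖h'‖ ≤ ρ → ∀ k, k < N → ∀ v : F k,
      ‖B h k v - B h' k v‖ ≤ b₀ * ‖h - h'‖ * ‖v‖)
    (hl : ∀ h h' : E 0, ‖h‖ ≤ ρ → ‖h'‖ ≤ ρ → ∀ k, k < N → ∀ (u : E k) (v : F k), ‖u‖ ≤ r →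
      ‖v‖ ≤ r → ‖S h k u v - S h' k u v‖ ≤ l₀ * ‖h - h'‖ * max ‖u‖ ‖v‖)
    (hm : ∀ h h' : E 0, ‖h‖ ≤ ρ → ‖h'‖ ≤ ρ → ‖y₀ h - y₀ h'‖ ≤ m₀ * ‖h - h'‖)
    (hsmall : max m₀ (max (l₀ * ε / η) ((α * b₀ + a₀ * (η + β + 2 * ρ * b₀)) * ε))
      ≤ (1 - κ) / 2) :
    ∃ h : E 0, ‖h‖ ≤ ρ ∧ ∃ (x : ∀ k, E k) (y : ∀ k, F k),
      IsTrajectory N (A h) (B h) (S h) (y₀ h) x y ∧ InTube N η ε x y ∧ x 0 = h ∧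
      ∀ k, k ≤ N → ‖x k‖ ≤ η ^ k * (‖y₀ h‖ / (1 - κ)) ∧ ‖y k‖ ≤ η ^ k * (‖y₀ h‖ / (1 - κ)) := by
  have hρ : 0 ≤ ρ := hε.trans hερ
  -- the tuned trajectory of system `h` (for `‖h‖ ≤ ρ`), by Theorem 12.1
  have hex : ∀ h : E 0, ‖h‖ ≤ ρ → ∃ (x : ∀ k, E k) (y : ∀ k, F k),
      IsTrajectory N (A h) (B h) (S h) (y₀ h) x y ∧ InTube N η ε x y ∧
      ∀ k, k ≤ N → ‖x k‖ ≤ η ^ k * (‖y₀ h‖ / (1 - κ)) ∧ ‖y k‖ ≤ η ^ k * (‖y₀ h‖ / (1 - κ)) :=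
    fun h hh => exists_isTrajectory (hT h hh) hη hη1 hα hβ hσ hκ₁ hκ₂ hκ hε hεr (hy₀ h hh)
  classical
  -- the map `Φ : h ↦ x_0(h)` (extended by `0` off the ball)
  let Φ : E 0 → E 0 := fun h =>
    if hh : ‖h‖ ≤ ρ then (Classical.choose (hex h hh)) 0 else 0
  have hΦ : ∀ h (hh : ‖h‖ ≤ ρ), Φ h = (Classical.choose (hex h hh)) 0 := fun h hh => by
    simp only [Φ, dif_pos hh]
  -- `Φ` maps the `ρ`-ball into itself (indeed into the `ε`-ball)
  have hmaps : ∀ h, ‖h‖ ≤ ρ → ‖Φ h‖ ≤ ρ := by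
    intro h hh
    rw [hΦ h hh]
    obtain ⟨y, -, htu, -⟩ := Classical.choose_spec (hex h hh)
    have := (htu 0 (Nat.zero_le _)).1
    rw [pow_zero, mul_one] at this
    exact this.trans hερ
  -- `Φ` is a `1/2`-contraction on the ball
  have hlip : ∀ h h', ‖h‖ ≤ ρ → ‖h'‖ ≤ ρ → ‖Φ h - Φ h'‖ ≤ (1 / 2) * ‖h - h'‖ := by
    intro h h' hh hh'
    rw [hΦ h hh, hΦ h' hh']
    obtain ⟨y, htr, htu, -⟩ := Classical.choose_spec (hex h hh)
    obtain ⟨y', htr', htu', -⟩ := Classical.choose_spec (hex h' hh')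
    set t := ‖h - h'‖ with ht
    have ht0 : 0 ≤ t := norm_nonneg _
    have ht2 : t ≤ 2 * ρ := by
      calc t ≤ ‖h‖ + ‖h'‖ := norm_sub_le _ _
        _ ≤ ρ + ρ := add_le_add hh hh'
        _ = 2 * ρ := by ring
    -- perturbation sizes `a = a₀ t`, `b = b₀ t`, `l = l₀ t`, `m = m₀ t`
    have hd := dist_le_of_isTrajectory (a := a₀ * t) (b := b₀ * t) (l := l₀ * t) (m := m₀ * t)
      (hT h hh) hη hη1 hα hβ hσ hκ₁ hκ₂ hκ hε hεr htr htr' htu htu'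
      (mul_nonneg ha0 ht0) (mul_nonneg hb0 ht0) (mul_nonneg hl0 ht0)
      (fun k hk w => ha h h' hh hh' k hk w) (fun k hk v => hb h h' hh hh' k hk v)
      (fun k hk u v hu hv => hl h h' hh hh' k hk u v hu hv) (hm h h' hh hh')
    have h0 := (hd 0 (Nat.zero_le _)).1
    rw [pow_zero, mul_one] at h0
    refine h0.trans ?_
    -- `pertSize … (a₀t) (b₀t) (l₀t) (m₀t) ≤ t · max(m₀, l₀ε/η, (αb₀ + a₀(η+β+2ρb₀))ε) ≤ t(1-κ)/2`
    have hP : pertSize α β η ε (a₀ * t) (b₀ * t) (l₀ * t) (m₀ * t) ≤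
        t * max m₀ (max (l₀ * ε / η) ((α * b₀ + a₀ * (η + β + 2 * ρ * b₀)) * ε)) := by
      unfold pertSize
      have e1 : m₀ * t = t * m₀ := mul_comm _ _
      have e2 : l₀ * t * ε / η = t * (l₀ * ε / η) := by ring
      have e3 : (α * (b₀ * t) + a₀ * t * (η + β + b₀ * t)) * ε =
          t * ((α * b₀ + a₀ * (η + β + b₀ * t)) * ε) := by ring
      rw [e1, e2, e3, ← mul_max_of_nonneg _ _ ht0, ← mul_max_of_nonneg _ _ ht0]
      refine mul_le_mul_of_nonneg_left (max_le_max le_rfl (max_le_max le_rfl ?_)) ht0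
      refine mul_le_mul_of_nonneg_right (add_le_add le_rfl ?_) hε
      refine mul_le_mul_of_nonneg_left (add_le_add le_rfl ?_) ha0
      calc b₀ * t ≤ b₀ * (2 * ρ) := mul_le_mul_of_nonneg_left ht2 hb0
        _ = 2 * ρ * b₀ := by ring
    have h1κ : 0 < 1 - κ := by linarith
    calc pertSize α β η ε (a₀ * t) (b₀ * t) (l₀ * t) (m₀ * t) / (1 - κ)
        ≤ t * max m₀ (max (l₀ * ε / η) ((α * b₀ + a₀ * (η + β + 2 * ρ * b₀)) * ε)) / (1 - κ) :=
          div_le_div_of_nonneg_right hP h1κ.le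
      _ ≤ t * ((1 - κ) / 2) / (1 - κ) :=
          div_le_div_of_nonneg_right (mul_le_mul_of_nonneg_left hsmall ht0) h1κ.le
      _ = 1 / 2 * t := by field_simp
  -- Banach on the closed `ρ`-ball of `E 0`
  obtain ⟨h, hh, hfix, -, -⟩ :=
    exists_fixedPt_of_lipschitz_of_norm_le (T := Φ) (κ := 1 / 2) (by norm_num) (by norm_num)
      hρ hlip hmaps
  refine ⟨h, hh, ?_⟩
  obtain ⟨y, htr, htu, hbd⟩ := Classical.choose_spec (hex h hh)
  refine ⟨Classical.choose (hex h hh), y, htr, htu, ?_, hbd⟩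
  rw [← hΦ h hh]
  exact hfix

end secondFixedPoint

end RGFlow

end Literature.Dynamics.Hyperbolic

end
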